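import Literature.IUT.HodgeArakelov.AbsTopMonoidsGenuineGhat
import Literature.IUT.HodgeArakelov.GaloisPairRigidity
import Mathlib.Topology.LocallyConstant.Basic
import Mathlib.Topology.Algebra.Group.Basic
import Mathlib.Topology.Connected.TotallyDisconnected
import Mathlib.Topology.Connected.Separation
import HarnessLib

/-!
# [IUTchII] Example 1.8 (vii) `(∗ĝp)` GENUINE, the IND-TOPOLOGY: the profinite topology on the levels `((k̄^×)^J)^∧` and
# the colimit topology on `O^ĝp(G) = lim→_J ((k̄^×)^J)^∧`; automorphisms of the TOPOLOGICAL pair `G ↷ O^ĝp(G)`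

S. Mochizuki, *Inter-universal Teichmüller theory II*, §1, Example 1.8 (vii), kurims manuscript (Dec. 2020) p. 40:
"`(∗ĝp)`": "by considering inductive limits of profinite completions of the `J`-invariants [as `J` ranges over the open
subgroups of `G`] of the underlying … modules … we obtain … `(G ↷ O^ĝp(G))` … these algorithms `(∗^ĝp)` are compatible
with a natural action of `Γ` on the underlying ind-topological modules" [claim: Mochizuki2012, status: disputed]
(IUTchII §1 Ex 1.8 (vii), kurims p.40); Remark 1.11.1 (i) (c) p. 50 ("the group of automorphisms of the underlying
ind-topological module equipped with a topological group action of `G ↷ O^ĝp(G)` maps surjectively … onto the group of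
automorphisms of the topological group `G`, with kernel … the natural action of `Ẑ^×`").  Classical carrier topology:
J. Neukirch, *Algebraic Number Theory*, Grundlehren 322 (1999), Ch. IV §2 p. 274 (profinite completion `lim G/N` with
its limit topology; `Ẑ`) [cite: NeukirchANT1999, Ch. IV §2 p.274].

abc-iut cell, layer L6, row «GHATGP-TOPOLOGY» (abc-iut-L6-lead gen 5 GO §F v1.19ay (1), 2026-08-26T16:25:36Z; post-freeze
def, reading (ii), FREEZE-L6 disclosure X-L6d2-GHAT3); seat abc-iut-L6-d2 (gen 7).  The ONE small def-bearing file of the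
row: it closes the modelling disclosure «ind-topologies NOT modelled» left on nodes IUTchII:Rmk1.11.1(i) / Rmk1.11.3(ii)
by abc-iut-L6-d2 gen 6 (`rmk1111_c_genuineGhat`, p452340, abstract automorphisms).  CONTENT:

* `PowCompletion.instTopologicalSpace` — the PROFINITE-COMPLETION topology on `Â = lim_n A/Aⁿ ⊆ ∏_n A/Aⁿ` for an
  abstract commutative group `A`: the coarsest topology making every component `Â → A/Aⁿ` locally constant (= the
  subspace topology of the product of the DISCRETE `A/Aⁿ`, `instTopologicalSpace_eq_induced_pi`).  `A` carries no
  topology anywhere in this development (abstract units of fixed fields), so no Mathlib instance is overridden or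
  duplicated.  API: `continuous_iff_isLocallyConstant` (a map into `Â` is continuous iff all its components are locally
  constant), `isLocallyConstant_component`, `IsTopologicalGroup`, `TotallySeparatedSpace` (hence `T2Space`,
  `TotallyDisconnectedSpace`), and `compactSpace_of_finite`: `Â` is COMPACT as soon as every `A/Aⁿ` is finite (closed
  subgroup of a product of finite discrete groups — Tychonoff), i.e. `Â` is then a profinite group.
* The colimit topology on `Genuine.Oghat C = DirectLimit (levelGroup C) (levelMap C)` comes FOR FREE from Mathlib: the
  type `DirectLimit` is (reducibly) the quotient of `Σ i, levelGroup C i`, so the Sigma and Quotient instances apply;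
  `topologicalSpace_oghat_eq_iSup_coinduced` records that this IS the final (inductive-limit) topology of the structure maps
  `ofLevel C i`, `continuous_ofLevel`, `isQuotientMap_sigmaOfLevel`, and the universal property
  `continuous_from_oghat_iff` (a map out of `O^ĝp` is continuous iff it is continuous on every level).
* `TopPairAut G M act` — print's "group of automorphisms of the underlying ind-topological module equipped with a
  topological group action of `G ↷ M`": abc-iut-L6-t1's `PairAut G M act` (pairs `(σ, ψ)`, `ψ(g·m) = σ(g)·ψ(m)`,
  `GaloisPairRigidity.lean` p409065, consumed BY NAME) cut down to the `ψ` that are HOMEOMORPHISMS; `TopPairAut.forget`,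
  `topPairAut_le_pairAut`.

The proof-only sequels (`GaloisPairRigidityRmk1111cTopological.lean`, `AbsTopMonoidsGenuineGhatTopologyProofs.lean`) prove:
the `G`-action `genuineGhatAct` and the `Ẑ^×`-action `zhatPowOghat` are continuous (levelwise componentwise maps), EVERY
abstract pair automorphism of `G ↷ O^ĝp(G)` at the genuine data is automatically a homeomorphism (`TopPairAut = PairAut`),
whence Remark 1.11.1 (i) (c) for the TOPOLOGICAL pair as a corollary of `rmk1111_c_genuineGhat`; the levels are profinite.
HONEST FRAMING: classical point-set topology / algebra over OUR typed objects; record-anchored to a disputed corpus through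
the locators only; nothing here bears on [IUTchIII] Cor. 3.12; typed ≠ proved elsewhere.
-/

noncomputable section

namespace Literature.IUT.HodgeArakelov

open CategoryTheory Topology

universe u

/-! ## The profinite-completion topology on `Â = lim_n A/Aⁿ` -/

namespace PowCompletion

variable {A : Type u} [CommGroup A]

/-- **The topology of the power completion `Â = lim_n A/Aⁿ`**: the coarsest topology for which every component
`Â → A/Aⁿ` is locally constant, i.e. the subspace topology of `∏_n A/Aⁿ` with the `A/Aⁿ` DISCRETE (the limit topology of
the profinite completion).  `A` is an abstract commutative group (no topology), so nothing is overridden.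
[cite: NeukirchANT1999, Ch. IV §2 p.274] -/
instance instTopologicalSpace : TopologicalSpace (PowCompletion A) :=
  ⨅ n : ℕ+, TopologicalSpace.induced (component n) ⊥

/-- The topology of `Â` is the subspace topology of the product of the discrete `A/Aⁿ` (along the components).
[cite: NeukirchANT1999, Ch. IV §2 p.274] -/
theorem instTopologicalSpace_eq_induced_pi :
    (instTopologicalSpace : TopologicalSpace (PowCompletion A)) =
      TopologicalSpace.induced (fun (x : PowCompletion A) (n : ℕ+) => component n x)
        (@Pi.topologicalSpace ℕ+ (fun n => A ⧸ powSubgroup A n) fun _ => ⊥) := by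
  change _ = TopologicalSpace.induced _ (⨅ n : ℕ+, TopologicalSpace.induced _ ⊥)
  rw [induced_iInf]
  simp_rw [induced_compose]
  rfl

/-- **Continuity criterion**: a map into `Â` is continuous iff each of its components `X → A/Aⁿ` is locally constant.
[cite: NeukirchANT1999, Ch. IV §2 p.274] -/
theorem continuous_iff_isLocallyConstant {X : Type*} [TopologicalSpace X] {f : X → PowCompletion A} :
    Continuous f ↔ ∀ n : ℕ+, IsLocallyConstant fun x => component n (f x) := by
  refine continuous_iInf_rng.trans (forall_congr' fun n => ?_)
  rw [continuous_induced_rng]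
  exact (@IsLocallyConstant.iff_continuous X _ _ ⊥ (discreteTopology_bot _) (fun x => component n (f x))).symm

/-- The components `Â → A/Aⁿ` are locally constant. [cite: NeukirchANT1999, Ch. IV §2 p.274] -/
theorem isLocallyConstant_component (n : ℕ+) : IsLocallyConstant (component (A := A) n) :=
  (continuous_iff_isLocallyConstant.mp continuous_id) n

/-- A map into `Â` all of whose components are locally constant is continuous. [cite: NeukirchANT1999, Ch. IV §2 p.274] -/
theorem continuous_of_isLocallyConstant {X : Type*} [TopologicalSpace X] {f : X → PowCompletion A}
    (h : ∀ n : ℕ+, IsLocallyConstant fun x => component n (f x)) : Continuous f :=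
  continuous_iff_isLocallyConstant.mpr h

/-- The fibres `{x | x_n = c}` of a component are clopen. [cite: NeukirchANT1999, Ch. IV §2 p.274] -/
theorem isClopen_setOf_component_eq (n : ℕ+) (c : A ⧸ powSubgroup A n) :
    IsClopen {x : PowCompletion A | component n x = c} :=
  (isLocallyConstant_component n).isClopen_fiber c

/-- `Â` is a topological group. [cite: NeukirchANT1999, Ch. IV §2 p.274] -/
instance instIsTopologicalGroup : IsTopologicalGroup (PowCompletion A) where
  continuous_mul := continuous_of_isLocallyConstant fun n => by
    have h : (fun p : PowCompletion A × PowCompletion A => component n (p.1 * p.2)) =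
        (fun p => component n p.1) * fun p => component n p.2 := funext fun p => map_mul _ _ _
    rw [h]
    exact ((isLocallyConstant_component n).comp_continuous continuous_fst).mul
      ((isLocallyConstant_component n).comp_continuous continuous_snd)
  continuous_inv := continuous_of_isLocallyConstant fun n => by
    have h : (fun x : PowCompletion A => component n x⁻¹) = (fun x => component n x)⁻¹ :=
      funext fun x => map_inv _ _
    rw [h]
    exact (isLocallyConstant_component n).inv

/-- `Â` is totally separated (two distinct elements differ in some component, whose fibre is clopen); hence Hausdorff
and totally disconnected. [cite: NeukirchANT1999, Ch. IV §2 p.274] -/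
instance instTotallySeparatedSpace : TotallySeparatedSpace (PowCompletion A) := by
  refine totallySeparatedSpace_iff_exists_isClopen.mpr fun x y hxy => ?_
  obtain ⟨n, hn⟩ : ∃ n : ℕ+, component n x ≠ component n y := by
    by_contra h
    push Not at h
    exact hxy (ext h)
  exact ⟨{z | component n z = component n x}, isClopen_setOf_component_eq n _, rfl, fun h => hn (Eq.symm h)⟩

/-- **`Â` is COMPACT when every `A/Aⁿ` is finite** (closed subgroup of the product of the finite discrete `A/Aⁿ`,
Tychonoff): `Â` is then a profinite group — e.g. for `A = L^×`, `L` a nonarchimedean local field.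
[cite: NeukirchANT1999, Ch. IV §2 p.274] -/
theorem compactSpace_of_finite (hfin : ∀ n : ℕ+, Finite (A ⧸ powSubgroup A n)) : CompactSpace (PowCompletion A) := by
  letI : ∀ n : ℕ+, TopologicalSpace (A ⧸ powSubgroup A n) := fun _ => ⊥
  haveI : ∀ n : ℕ+, DiscreteTopology (A ⧸ powSubgroup A n) := fun _ => ⟨rfl⟩
  haveI : ∀ n : ℕ+, CompactSpace (A ⧸ powSubgroup A n) := fun n => Finite.compactSpace
  let g : PowCompletion A → (∀ n : ℕ+, A ⧸ powSubgroup A n) := fun x n => component n x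
  have hg : IsClosedEmbedding g := by
    refine ⟨⟨⟨instTopologicalSpace_eq_induced_pi⟩, fun x y h => ext fun n => congrFun h n⟩, ?_⟩
    have hr : Set.range g = ⋂ (m : ℕ+) (n : ℕ+) (h : (m : ℕ) ∣ n), {x | proj A m n h (x n) = x m} := by
      ext x
      simp only [Set.mem_range, Set.mem_iInter, Set.mem_setOf_eq]
      constructor
      · rintro ⟨z, rfl⟩ m n h
        exact component_compat z m n h
      · intro hx
        exact ⟨mk x hx, rfl⟩
    rw [hr]
    refine isClosed_iInter fun m => isClosed_iInter fun n => isClosed_iInter fun h => ?_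
    exact isClosed_eq ((continuous_of_discreteTopology (f := proj A m n h)).comp (continuous_apply n))
      (continuous_apply m)
  exact hg.compactSpace

end PowCompletion

/-! ## The colimit topology on `O^ĝp = lim→_J ((k̄^×)^J)^∧` (from Mathlib's Sigma/Quotient instances) -/

namespace AbsTopMonoids.Genuine

open Literature.AnabelianGeometry.AbsoluteAnabelian

variable (C : MLFClosure.{0})

/-- The topology Mathlib puts on `O^ĝp = DirectLimit …` (a quotient of `Σ_J ((k̄^×)^J)^∧`) IS the inductive-limit (final)
topology of the structure maps `((k̄^×)^J)^∧ → O^ĝp`: the ind-topology of print's "inductive limit of profinite completions".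
[claim: Mochizuki2012, status: disputed] (IUTchII §1 Ex 1.8 (vii), kurims p.40) -/
theorem topologicalSpace_oghat_eq_iSup_coinduced :
    (inferInstance : TopologicalSpace (Oghat C)) =
      ⨆ i : GhatLevel C, TopologicalSpace.coinduced (ofLevel C i) inferInstance := by
  change TopologicalSpace.coinduced _ (⨆ i : GhatLevel C, TopologicalSpace.coinduced _ _) = _
  rw [coinduced_iSup]
  simp_rw [coinduced_compose]
  rfl

/-- The structure maps `((k̄^×)^J)^∧ → O^ĝp` are continuous. [claim: Mochizuki2012, status: disputed] (IUTchII §1 Ex 1.8 (vii), kurims p.40) -/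
theorem continuous_ofLevel (i : GhatLevel C) : Continuous (ofLevel C i) :=
  continuous_quotient_mk'.comp continuous_sigmaMk

/-- `Σ_J ((k̄^×)^J)^∧ → O^ĝp` is a quotient map (the colimit topology). [claim: Mochizuki2012, status: disputed] (IUTchII §1 Ex 1.8 (vii), kurims p.40) -/
theorem isQuotientMap_sigmaOfLevel :
    IsQuotientMap (fun p : (Σ i : GhatLevel C, levelGroup C i) => ofLevel C p.1 p.2) :=
  isQuotientMap_quotient_mk'

/-- **Universal property of the ind-topology**: a map out of `O^ĝp` is continuous iff it is continuous on every level.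
[claim: Mochizuki2012, status: disputed] (IUTchII §1 Ex 1.8 (vii), kurims p.40) -/
theorem continuous_from_oghat_iff {X : Type*} [TopologicalSpace X] {f : Oghat C → X} :
    Continuous f ↔ ∀ i : GhatLevel C, Continuous fun x => f (ofLevel C i x) :=
  (isQuotientMap_sigmaOfLevel C).continuous_iff.trans continuous_sigma_iff

/-- An endomorphism of `O^ĝp` that is given LEVELWISE — `f (ofLevel i x) = ofLevel (t i) (g i x)` with the `g i`
continuous — is continuous (the shape of `zhatPowOghat`, `transportOghat`, `galActOghat`).
[claim: Mochizuki2012, status: disputed] (IUTchII §1 Ex 1.8 (vii), kurims p.40) -/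
theorem continuous_of_levelwise {f : Oghat C → Oghat C} (t : GhatLevel C → GhatLevel C)
    (g : ∀ i, levelGroup C i → levelGroup C (t i)) (hg : ∀ i, Continuous (g i))
    (hf : ∀ i x, f (ofLevel C i x) = ofLevel C (t i) (g i x)) : Continuous f := by
  refine (continuous_from_oghat_iff C).mpr fun i => ?_
  simp_rw [hf i]
  exact (continuous_ofLevel C (t i)).comp (hg i)

end AbsTopMonoids.Genuine

/-! ## Automorphisms of a TOPOLOGICAL pair `G ↷ M` -/

variable {S : ThetaSetting.{u}}

/-- **IUTchII:Rmk1.11.1(i)**, the group of automorphisms of a TOPOLOGICAL pair "`G ↷ M`" (print: "the group of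
automorphisms of the underlying ind-topological module equipped with a topological group action"): the pairs
`(σ, ψ) ∈ PairAut G M act` (abc-iut-L6-t1, `GaloisPairRigidity.lean`: `σ ∈ Aut(G)` an isomorphism of TOPOLOGICAL groups,
`ψ ∈ Aut(M)`, `ψ(g·m) = σ(g)·ψ(m)`) whose `ψ` is a HOMEOMORPHISM (`ψ` and `ψ⁻¹` continuous), as a subgroup of
`Aut(G) × Aut(M)`. [claim: Mochizuki2012, status: disputed] (IUTchII §1 Rmk 1.11.1 (i), kurims pp.49-50) -/
def TopPairAut (G : IsoClass S.Gk) (M : Type u) [Monoid M] [TopologicalSpace M] (act : G.G →* MulAut M) :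
    Subgroup (Aut G × MulAut M) where
  carrier := {p | p ∈ PairAut G M act ∧ Continuous p.2 ∧ Continuous p.2.symm}
  mul_mem' := by
    intro p q hp hq
    refine ⟨(PairAut G M act).mul_mem hp.1 hq.1, ?_, ?_⟩
    · change Continuous fun m => p.2 (q.2 m)
      exact hp.2.1.comp hq.2.1
    · change Continuous fun m => q.2.symm (p.2.symm m)
      exact hq.2.2.comp hp.2.2
  one_mem' := ⟨(PairAut G M act).one_mem, continuous_id, continuous_id⟩
  inv_mem' := by
    intro p hp
    exact ⟨(PairAut G M act).inv_mem hp.1, hp.2.2, hp.2.1⟩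

/-- Membership in `TopPairAut`: an abstract pair automorphism whose `M`-part is a homeomorphism.
[claim: Mochizuki2012, status: disputed] (IUTchII §1 Rmk 1.11.1 (i), kurims pp.49-50) -/
theorem mem_topPairAut_iff {G : IsoClass S.Gk} {M : Type u} [Monoid M] [TopologicalSpace M] {act : G.G →* MulAut M}
    (p : Aut G × MulAut M) :
    p ∈ TopPairAut G M act ↔ p ∈ PairAut G M act ∧ Continuous p.2 ∧ Continuous p.2.symm := Iff.rfl

/-- Topological pair automorphisms are pair automorphisms. [claim: Mochizuki2012, status: disputed] (IUTchII §1 Rmk 1.11.1 (i), kurims pp.49-50) -/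
theorem topPairAut_le_pairAut (G : IsoClass S.Gk) (M : Type u) [Monoid M] [TopologicalSpace M]
    (act : G.G →* MulAut M) : TopPairAut G M act ≤ PairAut G M act := fun _ hp => hp.1

/-- The forgetful map `Aut(G ↷ M)_{top} → Aut(G)` "[i.e., by forgetting `M`]".
[claim: Mochizuki2012, status: disputed] (IUTchII §1 Rmk 1.11.1 (i), kurims p.50) -/
def TopPairAut.forget {G : IsoClass S.Gk} {M : Type u} [Monoid M] [TopologicalSpace M] {act : G.G →* MulAut M}
    (p : TopPairAut G M act) : Aut G := p.1.1

/-- `TopPairAut.forget` is the restriction of abc-iut-L6-t1's `PairAut.forget` along the inclusion.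
[claim: Mochizuki2012, status: disputed] (IUTchII §1 Rmk 1.11.1 (i), kurims p.50) -/
theorem TopPairAut.forget_eq {G : IsoClass S.Gk} {M : Type u} [Monoid M] [TopologicalSpace M] {act : G.G →* MulAut M}
    (p : TopPairAut G M act) :
    TopPairAut.forget p = PairAut.forget (⟨p.1, topPairAut_le_pairAut G M act p.2⟩ : PairAut G M act) := rfl

end Literature.IUT.HodgeArakelov

end
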